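import Literature.InformationTheory.QuantumLearning.ClassicalShadows
import Literature.Computability.Complexity.WeightedChebyshevMean
import Literature.Computability.Complexity.MedianOfMeans
import Mathlib.Analysis.Matrix.PosDef
import HarnessLib

/-!
# Sample complexity of classical shadows for a `k`-local Pauli observable (median of means)

Topic `Literature/InformationTheory/QuantumLearning`; the end-to-end companion of
`ClassicalShadows.lean` (random single-qubit Pauli-basis measurements, the snapshot
`ρ̂ = ⊗ᵢ(3Πᵢ − 1)`, unbiasedness and the `3^k` variance law).  Huang, Kueng and Preskill's
Theorem 1 / Theorem S1 turns the variance bound into a SAMPLE COUNT by the median-of-means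
estimator: `K` batch means of `N` snapshots each, `N ∝ Var/ε²` by Chebyshev, failure probability
`e^{−Θ(K)}` by the median trick.  This file carries that composition out for one `k`-local Pauli
observable `σ_S` and an arbitrary state `ρ` (positive semidefinite, unit trace), entirely in the
finite product-weight language of `Literature/Computability/Complexity/{WeightedChebyshevMean,
MedianOfMeans}.lean` — no measure theory, no named facts, no `sorry`.

* `weight ρ r` — the probability of the measurement record `r = (b, s)` (setting word `b`, outcome
  string `s`): `3^{-n} Tr(Π_{b,s} ρ)` on settings, `0` on words with an identity letter; it is
  nonnegative for PSD `ρ` (`weight_nonneg`, via `Π = Π² = Πᴴ` and `Tr(Π ρ Πᴴ) ≥ 0`) and sums to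
  `1` for unit trace (`sum_weight_eq_one`).
* `estR S r` — the real single-shot estimate `Tr(σ_S ρ̂(r)) = ∏ (1 | 3(−1)^{sᵢ} | 0)`
  (`pauliEst_eq_estR`), with mean `Tr(σ_S ρ)` (`sum_weight_mul_estR`) and variance `≤ 3^k`
  (`sum_weight_mul_sq_sub_le`, from `variance_pauliEst_re_le`).
* `weight_batchMean_far_le` — Chebyshev for one batch of `m` snapshots:
  weight{|batch mean − Tr(σ_S ρ)| ≥ η} `≤ 3^k/(m η²)`.
* `weight_medianOfMeans_far_le_exp` / `weight_medianOfMeans_far_le` — **the sample-complexity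
  theorem**: with batches of size `m ≥ 4·3^k/η²` and `q ≥ 1` batches, every median of the `q`
  batch means is `η`-far from `Tr(σ_S ρ)` with total weight `≤ e^{−q/8}`, hence `≤ δ` once
  `q ≥ 8 ln(1/δ)`; in all `m·q = O(3^k log(1/δ)/η²)` snapshots, independent of the number of
  qubits — HKP20 Theorem 1 for a single Pauli observable.
* `weight_medianOfMeans_far_any_le` — **`M` observables** (union bound, `δ ← δ/M`): for Pauli
  words `O₁ … O_M` of weight `≤ k`, batches of size `m ≥ 4·3^k/η²` and `q ≥ 8 ln(M/δ)` batches,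
  ALL `M` medians are `η`-accurate simultaneously off weight `≤ δ` — `O(3^k log(M/δ)/η²)`
  snapshots, the `log M` dependence of HKP20 Theorem 1.

Constants: the paper states `N = 34σ²/ε²` per batch and `K = 2 log(2M/δ)` batches with failure
`2e^{−K/2}`; here the batch failure is pushed to `1/4` by Chebyshev and the median step is the
Hoeffding form `e^{−q/8}` of `MedianOfMeans.lean` (Jerrum–Valiant–Vazirani), so the constants read
`4·3^k/η²` and `8 ln(1/δ)` — the same theorem up to these absolute constants.

## References
* H.-Y. Huang, R. Kueng, J. Preskill, *Predicting many properties of a quantum system from very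
  few measurements*, Nature Physics 16 (2020) 1050–1057 = arXiv:2002.08953: main text Theorem 1;
  Supplementary Information §1.B Theorem S1 and Lemma S1 (median of means), §5.C Lemma S3
  (`‖σ_S‖²_shadow = 3^k`) [HuangKuengPreskill2020].  Locator: Theorem S1 of the Nat. Phys. SI =
  Theorem 3 of the arXiv:2002.08953 text (held materialisation p0016 L40–L63: `K = 2 log(2M/δ)`,
  `N = (34/ε²) maxᵢ ‖Oᵢ − tr(Oᵢ)/2ⁿ 𝕀‖²_shadow`, 'Apply a union bound over all M failure
  probabilities to deduce the claim').
* M. R. Jerrum, L. G. Valiant, V. V. Vazirani, *Random generation of combinatorial structures from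
  a uniform distribution*, TCS 43 (1986), Lemma 6.1 (median trick) [JerrumValiantVazirani1986].
-/

noncomputable section

open Matrix Finset Literature.Computability.QuantumComplexity Literature.Computability.Complexity
open scoped ComplexOrder

namespace Literature.InformationTheory.QuantumLearning

namespace PauliShadow

variable {ι : Type*} [Fintype ι] [DecidableEq ι]

/-! ## The measurement POVM elements are Hermitian projectors -/

/-- `Π_{Q,t}² = Π_{Q,t}`: each single-qubit element is a projector (uses `σ_Q² = 1`).
[cite: HuangKuengPreskill2020, SI §5.C Proposition S2 (rank-one projectors U†|b⟩⟨b|U)] -/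
theorem proj_mul_self (Q : Pauli) (t : Bool) : proj Q t * proj Q t = proj Q t := by
  have hc : sgn t * sgn t = 1 := by cases t <;> simp [sgn]
  have hA : (1 + sgn t • Q.mat) * (1 + sgn t • Q.mat) =
      (1 + sgn t • Q.mat) + (1 + sgn t • Q.mat) := by
    rw [add_mul, mul_add, mul_add, one_mul, mul_one, one_mul, Matrix.smul_mul, Matrix.mul_smul,
      smul_smul, hc, Pauli.mat_mul_self, one_smul]
    abel
  unfold proj
  rw [smul_mul_assoc, mul_smul_comm, smul_smul, hA, ← two_smul ℂ, smul_smul]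
  norm_num

/-- `Π_{Q,t}ᴴ = Π_{Q,t}`: each single-qubit element is Hermitian.
[cite: HuangKuengPreskill2020, SI §5.C Proposition S2] -/
theorem conjTranspose_proj (Q : Pauli) (t : Bool) : (proj Q t)ᴴ = proj Q t := by
  ext a b
  cases Q <;> cases t <;> cases a <;> cases b <;>
    simp [proj, sgn, Pauli.mat, Matrix.conjTranspose_apply] <;> norm_num

/-- `Π_{b,s}² = Π_{b,s}`. [cite: HuangKuengPreskill2020, SI §5.C Proposition S2] -/
theorem povm_mul_self (b : ι → Pauli) (s : ι → Bool) : povm b s * povm b s = povm b s := by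
  unfold povm
  rw [tensorAll_mul]
  simp only [proj_mul_self]

omit [DecidableEq ι] in
/-- `Π_{b,s}ᴴ = Π_{b,s}`. [cite: HuangKuengPreskill2020, SI §5.C Proposition S2] -/
theorem conjTranspose_povm (b : ι → Pauli) (s : ι → Bool) : (povm b s)ᴴ = povm b s := by
  unfold povm
  rw [conjTranspose_tensorAll]
  simp only [conjTranspose_proj]

/-- Born weights of a positive semidefinite `ρ` are nonnegative: `Re Tr(Π ρ) = Re Tr(Π ρ Πᴴ) ≥ 0`.
[cite: HuangKuengPreskill2020, SI §1.A (Born's rule probabilities)] -/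
theorem bornWeight_re_nonneg {ρ : Matrix (ι → Bool) (ι → Bool) ℂ} (hρ : ρ.PosSemidef)
    (b : ι → Pauli) (s : ι → Bool) : 0 ≤ (bornWeight ρ b s).re := by
  have h : bornWeight ρ b s = (povm b s * ρ * (povm b s)ᴴ).trace := by
    rw [bornWeight, conjTranspose_povm, Matrix.trace_mul_cycle, povm_mul_self]
  rw [h]
  exact (Complex.nonneg_iff.mp (hρ.mul_mul_conjTranspose_same (povm b s)).trace_nonneg).1

/-! ## Records, real weights and the real single-shot estimate -/

/-- A measurement record: the setting word `b ∈ {I,X,Y,Z}^ι` (weight zero unless identity-free) and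
the outcome string `s`. [cite: HuangKuengPreskill2020, main text (data (Uᵢ, b̂ᵢ))] -/
abbrev Record (ι : Type*) := (ι → Pauli) × (ι → Bool)

/-- The probability of a record as a real number: `Re (prob ρ b s)` on settings, `0` elsewhere.
[cite: HuangKuengPreskill2020, SI §1.A] -/
def weight (ρ : Matrix (ι → Bool) (ι → Bool) ℂ) (r : Record ι) : ℝ :=
  if r.1 ∈ (settings : Finset (ι → Pauli)) then (prob ρ r.1 r.2).re else 0

/-- The real sign `(−1)^t`. [cite: HuangKuengPreskill2020, SI §5.C Proposition S2] -/
def sgnR (t : Bool) : ℝ := if t then -1 else 1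

/-- The real single-shot estimate `Tr(σ_S ρ̂(b,s)) = ∏ᵢ (1 if Sᵢ = I | 3(−1)^{sᵢ} if Sᵢ = bᵢ | 0)`.
[cite: HuangKuengPreskill2020, SI §5.C Proposition S2 with Lemma S3] -/
def estR (S : ι → Pauli) (r : Record ι) : ℝ :=
  ∏ i, if S i = Pauli.I then 1 else if S i = r.1 i then 3 * sgnR (r.2 i) else 0

omit [DecidableEq ι] in
/-- The complex estimate of `ClassicalShadows.lean` is the real one.
[cite: HuangKuengPreskill2020, SI §5.C Proposition S2] -/
theorem pauliEst_eq_estR (S b : ι → Pauli) (s : ι → Bool) :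
    pauliEst S b s = (estR S (b, s) : ℂ) := by
  unfold pauliEst estR
  rw [Complex.ofReal_prod]
  refine Finset.prod_congr rfl fun i _ => ?_
  rcases Bool.eq_false_or_eq_true (s i) with h | h <;>
    split_ifs <;> simp [sgn, sgnR, h]

/-- The weight of a record is nonnegative for positive semidefinite `ρ`.
[cite: HuangKuengPreskill2020, SI §1.A] -/
theorem weight_nonneg {ρ : Matrix (ι → Bool) (ι → Bool) ℂ} (hρ : ρ.PosSemidef) (r : Record ι) :
    0 ≤ weight ρ r := by
  unfold weight
  split_ifs with hb
  · rw [prob, show (1 / 3 : ℂ) ^ Fintype.card ι = (((1 / 3 : ℝ) ^ Fintype.card ι : ℝ) : ℂ) by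
      push_cast; ring, Complex.re_ofReal_mul]
    exact mul_nonneg (by positivity) (bornWeight_re_nonneg hρ _ _)
  · exact le_rfl

/-- Transfer from the complex sums of `ClassicalShadows.lean`:
`Σ_r weight ρ r · F r = Re Σ_{b ∈ settings} Σ_s prob ρ b s · F(b,s)` for real `F`. [folklore] -/
private theorem sum_weight_mul (ρ : Matrix (ι → Bool) (ι → Bool) ℂ)
    (F : (ι → Pauli) → (ι → Bool) → ℝ) :
    ∑ r : Record ι, weight ρ r * F r.1 r.2 =
      (∑ b ∈ settings, ∑ s, prob ρ b s * (F b s : ℂ)).re := by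
  rw [Fintype.sum_prod_type, Complex.re_sum]
  have hzero : ∀ b ∈ (univ : Finset (ι → Pauli)), b ∉ (settings : Finset (ι → Pauli)) →
      ∑ s : ι → Bool, weight ρ (b, s) * F b s = 0 := by
    intro b _ hb
    simp [weight, hb]
  rw [← Finset.sum_subset (Finset.subset_univ _) hzero]
  refine Finset.sum_congr rfl fun b hb => ?_
  rw [Complex.re_sum]
  refine Finset.sum_congr rfl fun s _ => ?_
  simp [weight, hb, Complex.mul_re]

/-- The weights sum to one for a unit-trace `ρ`. [cite: HuangKuengPreskill2020, SI §1.A] -/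
theorem sum_weight_eq_one (ρ : Matrix (ι → Bool) (ι → Bool) ℂ) (hρ1 : ρ.trace = 1) :
    ∑ r : Record ι, weight ρ r = 1 := by
  have h := sum_weight_mul ρ fun _ _ => 1
  simp only [mul_one, Complex.ofReal_one, sum_prob, hρ1, Complex.one_re] at h
  exact h

/-- Pauli coefficients of a Hermitian matrix are real. [folklore] -/
private theorem ofReal_re_pauliCoeff {ρ : Matrix (ι → Bool) (ι → Bool) ℂ} (hρ : ρ.IsHermitian)
    (S : ι → Pauli) : (((pauliCoeff ρ S).re : ℝ) : ℂ) = pauliCoeff ρ S := by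
  have h : star (pauliCoeff ρ S) = pauliCoeff ρ S := by
    rw [pauliCoeff_eq, ← Matrix.trace_conjTranspose, Matrix.conjTranspose_mul, hρ.eq,
      conjTranspose_pauliString, Matrix.trace_mul_comm]
  exact Complex.conj_eq_iff_re.mp h

/-- **Unbiasedness, real form**: `Σ_r weight ρ r · estR S r = Re Tr(σ_S ρ)`
(`pauliCoeff ρ S = Tr(σ_S ρ)`, real for Hermitian `ρ`).
[cite: HuangKuengPreskill2020, SI §1.B (𝔼 ô = tr(Oρ))] -/
theorem sum_weight_mul_estR (ρ : Matrix (ι → Bool) (ι → Bool) ℂ) (S : ι → Pauli) :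
    ∑ r : Record ι, weight ρ r * estR S r = (pauliCoeff ρ S).re := by
  have h := sum_weight_mul ρ fun b s => estR S (b, s)
  simp only [← pauliEst_eq_estR, expect_pauliEst] at h
  exact h

/-- **Variance bound, real form**: `Σ_r weight ρ r · (estR S r − Re pauliCoeff ρ S)² ≤ 3^{|S|}` for
a Hermitian unit-trace `ρ`. [cite: HuangKuengPreskill2020, SI §1.B Lemma S1 with §5.C Lemma S3] -/
theorem sum_weight_mul_sq_sub_le (ρ : Matrix (ι → Bool) (ι → Bool) ℂ) (hH : ρ.IsHermitian)
    (hρ1 : ρ.trace = 1) (S : ι → Pauli) :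
    ∑ r : Record ι, weight ρ r * (estR S r - (pauliCoeff ρ S).re) ^ 2 ≤
      3 ^ PauliPath.strWeight S := by
  have h := sum_weight_mul ρ fun b s => (estR S (b, s) - (pauliCoeff ρ S).re) ^ 2
  simp only [Complex.ofReal_pow, Complex.ofReal_sub, ← pauliEst_eq_estR,
    ofReal_re_pauliCoeff hH] at h
  rw [h]
  exact variance_pauliEst_re_le ρ hρ1 hH S

/-! ## Batches, Chebyshev, and the median of means -/

/-- The empirical mean of the estimate over a batch of `m` records.
[cite: HuangKuengPreskill2020, SI §1.B (sample means of size N)] -/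
def batchMean (S : ι → Pauli) {m : ℕ} (β : Fin m → Record ι) : ℝ :=
  (∑ i, estR S (β i)) / m

/-- Independent batches have total weight one. [folklore] -/
private theorem sum_prod_weight_eq_one (ρ : Matrix (ι → Bool) (ι → Bool) ℂ) (hρ1 : ρ.trace = 1)
    (m : ℕ) : ∑ β : Fin m → Record ι, ∏ i, weight ρ (β i) = 1 := by
  rw [← Fintype.prod_sum (fun (_ : Fin m) (r : Record ι) => weight ρ r)]
  simp [sum_weight_eq_one ρ hρ1]

/-- **Chebyshev for one batch**: for a state `ρ` (PSD, unit trace), `m ≥ 1` independent snapshots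
and `η > 0`, the records whose batch mean of `Tr(σ_S ρ̂)` is `η`-far from its expectation have
total weight `≤ 3^{|S|}/(m η²)`.
[cite: HuangKuengPreskill2020, SI §1.B proof of Theorem S1 (sample means of size N = 34σ²/ε²)
with §5.C Lemma S3 (σ² ≤ 3^k)] -/
theorem weight_batchMean_far_le (ρ : Matrix (ι → Bool) (ι → Bool) ℂ) (hρ : ρ.PosSemidef)
    (hρ1 : ρ.trace = 1) (S : ι → Pauli) {m : ℕ} (hm : 0 < m) {η : ℝ} (hη : 0 < η) :
    ∑ β ∈ univ.filter (fun β : Fin m → Record ι => η ≤ |batchMean S β - (pauliCoeff ρ S).re|),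
      ∏ i, weight ρ (β i) ≤ 3 ^ PauliPath.strWeight S / (m * η ^ 2) :=
  sum_weight_mean_far_le (weight ρ) (weight_nonneg hρ) (sum_weight_eq_one ρ hρ1) (estR S)
    (sum_weight_mul_estR ρ S) (sum_weight_mul_sq_sub_le ρ hρ.isHermitian hρ1 S) hm hη

/-- **Sample complexity of classical shadows, one `k`-local Pauli observable (median of means).**
State `ρ` (PSD, unit trace); `q ≥ 1` independent batches of `m` independent random-Pauli-basis
snapshots each, with `m η² ≥ 4·3^{|S|}`; `med R` any median of the `q` batch means of
`Tr(σ_S ρ̂)`.  Then the records `R` for which `|med R − Tr(σ_S ρ)| ≥ η`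
(`Tr(σ_S ρ) = pauliCoeff ρ S`) have total product weight `≤ e^{−q/8}`.
[cite: HuangKuengPreskill2020, main text Theorem 1; SI §1.B Theorem S1 (= Theorem 3 of the
arXiv:2002.08953 text, p0016 L40–L63) & Lemma S1 (median of means: N = 34σ²/ε² per batch,
failure 2e^{−K/2}); §5.C Lemma S3 (3^k)];
[cite: JerrumValiantVazirani1986, Lemma 6.1 (median trick)] -/
theorem weight_medianOfMeans_far_le_exp (ρ : Matrix (ι → Bool) (ι → Bool) ℂ) (hρ : ρ.PosSemidef)
    (hρ1 : ρ.trace = 1) (S : ι → Pauli) {η : ℝ} (hη : 0 < η) {m : ℕ}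
    (hm : 4 * (3 : ℝ) ^ PauliPath.strWeight S ≤ m * η ^ 2) {q : ℕ} (hq : 0 < q)
    (med : (Fin q → Fin m → Record ι) → ℝ)
    (hmed : ∀ R, IsMedian (fun j => batchMean S (R j)) (med R)) :
    ∑ R ∈ univ.filter (fun R : Fin q → Fin m → Record ι => η ≤ |med R - (pauliCoeff ρ S).re|),
      ∏ j, ∏ i, weight ρ (R j i) ≤ Real.exp (-(q : ℝ) / 8) := by
  have hpow : (0 : ℝ) < 4 * 3 ^ PauliPath.strWeight S := by positivity
  have hm0 : 0 < m := by
    rcases Nat.eq_zero_or_pos m with h | h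
    · subst h
      simp only [Nat.cast_zero, zero_mul] at hm
      linarith
    · exact h
  have hmpos : (0 : ℝ) < m * η ^ 2 := by positivity
  have hbad : ∑ β ∈ univ.filter
      (fun β : Fin m → Record ι => η ≤ |batchMean S β - (pauliCoeff ρ S).re|),
      ∏ i, weight ρ (β i) ≤ 1 / 4 := by
    refine (weight_batchMean_far_le ρ hρ hρ1 S hm0 hη).trans ?_
    rw [div_le_iff₀ hmpos]
    linarith
  exact sum_weight_median_far_le_exp (fun β : Fin m → Record ι => ∏ i, weight ρ (β i))
    (fun β => Finset.prod_nonneg fun i _ => weight_nonneg hρ (β i))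
    (sum_prod_weight_eq_one ρ hρ1 m) (batchMean S) ((pauliCoeff ρ S).re) η hbad hq med hmed

/-- **Sample complexity, `(η, δ)` form**: batches of size `m ≥ 4·3^{|S|}/η²`, `q ≥ 8 ln(1/δ)`
batches (`q ≥ 1`) — `m·q = O(3^k log(1/δ)/η²)` snapshots in all, independent of the number of
qubits — make every median of the batch means `η`-accurate for `Tr(σ_S ρ)` except on records of
total weight `≤ δ`.  (A median always exists: `exists_isMedian`.)
[cite: HuangKuengPreskill2020, main text Theorem 1 (N_tot = O(log(M) max‖Oᵢ‖²_shadow/ε²)) and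
eq. (5) (‖O‖²_shadow ≤ 3^k for k-local Pauli observables); SI §1.B Theorem S1] -/
theorem weight_medianOfMeans_far_le (ρ : Matrix (ι → Bool) (ι → Bool) ℂ) (hρ : ρ.PosSemidef)
    (hρ1 : ρ.trace = 1) (S : ι → Pauli) {η : ℝ} (hη : 0 < η) {m : ℕ}
    (hm : 4 * (3 : ℝ) ^ PauliPath.strWeight S ≤ m * η ^ 2) {q : ℕ} (hq : 0 < q) {δ : ℝ}
    (hδ : 0 < δ) (hqδ : 8 * Real.log (1 / δ) ≤ q) (med : (Fin q → Fin m → Record ι) → ℝ)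
    (hmed : ∀ R, IsMedian (fun j => batchMean S (R j)) (med R)) :
    ∑ R ∈ univ.filter (fun R : Fin q → Fin m → Record ι => η ≤ |med R - (pauliCoeff ρ S).re|),
      ∏ j, ∏ i, weight ρ (R j i) ≤ δ :=
  (weight_medianOfMeans_far_le_exp ρ hρ hρ1 S hη hm hq med hmed).trans
    (exp_neg_div_eight_le hδ hqδ)

/-! ## Many observables: the union bound -/

/-- Union bound in product-weight form: the weight of `{x : ∃ a, P a x}` is at most the sum over `a`
of the weights of `{x : P a x}` (nonnegative weights). [folklore] -/
private theorem sum_filter_exists_le {γ : Type*} [Fintype γ] {M : ℕ} (W : γ → ℝ)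
    (hW : ∀ x, 0 ≤ W x) (P : Fin M → γ → Prop) [∀ a, DecidablePred (P a)]
    [DecidablePred fun x => ∃ a, P a x] :
    ∑ x ∈ univ.filter (fun x => ∃ a, P a x), W x ≤ ∑ a, ∑ x ∈ univ.filter (P a), W x := by
  rw [Finset.sum_filter]
  simp_rw [Finset.sum_filter]
  rw [Finset.sum_comm]
  refine Finset.sum_le_sum fun x _ => ?_
  have h0 : ∀ a : Fin M, 0 ≤ if P a x then W x else 0 := fun a => by
    split_ifs
    · exact hW x
    · exact le_rfl
  by_cases h : ∃ a, P a x
  · obtain ⟨a, ha⟩ := h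
    rw [if_pos ⟨a, ha⟩]
    calc W x = if P a x then W x else 0 := by rw [if_pos ha]
      _ ≤ ∑ a', (if P a' x then W x else 0) := Finset.single_le_sum (fun a' _ => h0 a') (mem_univ a)
  · rw [if_neg h]
    exact Finset.sum_nonneg fun a _ => h0 a

/-- **Sample complexity for `M` Pauli observables (HKP20 Theorem 1, random Pauli measurements).**
State `ρ` (PSD, unit trace); Pauli words `O a` (`a < M`) with `4·3^{|O a|} ≤ m η²` for every `a`
(e.g. all of weight `≤ k` and `m ≥ 4·3^k/η²`); `q ≥ 8 ln(M/δ)` batches (`q ≥ 1`) of `m` snapshots;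
`med a R` any median of the `q` batch means for observable `a`.  Then the records on which SOME
median is `η`-far from its `Tr(σ_{O a} ρ)` have total weight `≤ δ`: all `M` expectation values are
predicted to accuracy `η` from `m·q = O(3^k log(M/δ)/η²)` measurements, independent of the number
of qubits.  Proof: union bound over `weight_medianOfMeans_far_le_exp` with `δ ← δ/M`.
[cite: HuangKuengPreskill2020, main text Theorem 1 (N = O(log(M) maxᵢ‖Oᵢ‖²_shadow/ε²)) with
eq. (5); SI §1.B Theorem S1 = Theorem 3 of the arXiv:2002.08953 text (p0016 L40–L63:
K = 2 log(2M/δ), union bound over i)] -/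
theorem weight_medianOfMeans_far_any_le (ρ : Matrix (ι → Bool) (ι → Bool) ℂ) (hρ : ρ.PosSemidef)
    (hρ1 : ρ.trace = 1) {M : ℕ} (O : Fin M → ι → Pauli) {η : ℝ} (hη : 0 < η) {m : ℕ}
    (hm : ∀ a, 4 * (3 : ℝ) ^ PauliPath.strWeight (O a) ≤ m * η ^ 2) {q : ℕ} (hq : 0 < q)
    {δ : ℝ} (hδ : 0 < δ) (hqδ : 8 * Real.log (M / δ) ≤ q)
    (med : Fin M → (Fin q → Fin m → Record ι) → ℝ)
    (hmed : ∀ a R, IsMedian (fun j => batchMean (O a) (R j)) (med a R)) :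
    ∑ R ∈ univ.filter (fun R : Fin q → Fin m → Record ι =>
        ∃ a, η ≤ |med a R - (pauliCoeff ρ (O a)).re|), ∏ j, ∏ i, weight ρ (R j i) ≤ δ := by
  rcases Nat.eq_zero_or_pos M with hM | hM
  · subst hM
    have h0 : univ.filter (fun R : Fin q → Fin m → Record ι =>
        ∃ a : Fin 0, η ≤ |med a R - (pauliCoeff ρ (O a)).re|) = ∅ := by
      ext R
      simp
    rw [h0, Finset.sum_empty]
    exact hδ.le
  · have hMr : (0 : ℝ) < M := by exact_mod_cast hM
    have hδ' : 0 < δ / M := div_pos hδ hMr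
    have hq' : 8 * Real.log (1 / (δ / M)) ≤ q := by rwa [one_div_div]
    calc ∑ R ∈ univ.filter (fun R : Fin q → Fin m → Record ι =>
          ∃ a, η ≤ |med a R - (pauliCoeff ρ (O a)).re|), ∏ j, ∏ i, weight ρ (R j i)
        ≤ ∑ a, ∑ R ∈ univ.filter (fun R : Fin q → Fin m → Record ι =>
            η ≤ |med a R - (pauliCoeff ρ (O a)).re|), ∏ j, ∏ i, weight ρ (R j i) :=
          sum_filter_exists_le _
            (fun R => Finset.prod_nonneg fun j _ => Finset.prod_nonneg fun i _ =>
              weight_nonneg hρ (R j i))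
            (fun a R => η ≤ |med a R - (pauliCoeff ρ (O a)).re|)
      _ ≤ ∑ _a : Fin M, δ / M :=
          Finset.sum_le_sum fun a _ =>
            (weight_medianOfMeans_far_le_exp ρ hρ hρ1 (O a) hη (hm a) hq (med a) (hmed a)).trans
              (exp_neg_div_eight_le hδ' hq')
      _ = δ := by
          rw [Finset.sum_const, Finset.card_univ, Fintype.card_fin, nsmul_eq_mul]
          field_simp

end PauliShadow

end Literature.InformationTheory.QuantumLearning

end
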